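import Summits.Schanuel.Schanuel.Theorems.ZilberEacHyperellipticSheetFibres
import HarnessLib

/-!
# Arbitrary base branches, LIX: RATIONAL fibres over `x₁² = P(x₀)`, `deg P ≥ 3`, by the flat
# sheets — dense whenever the norms of numerator and denominator have different degrees

HONEST FRAMING.  Cell `pub-schanuel` (Zilber's Exponential-Algebraic Closedness, case ladder;
host summit Schanuel), seat 2, gen 30.  In the residue class `deg P ≡ 2 (mod 4)` the principal
sheet has no good direction, and file LVII does not apply; the flat route of file XXXVI needs a
rational fibre value `f = (A + x₁B)/(A' + x₁B')` of NONZERO order at one of the two places `±Φ` at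
infinity.  The two orders satisfy `L₊ + L₋ = 2(deg N_Q − deg N_R)` with the norms
`N_R = A² − PB²`, `N_Q = A'² − PB'²` (the product of the two sheet values is `N_R/N_Q (x₀)`), so
`deg N_R ≠ deg N_Q` forces `L₊ ≠ 0 ∨ L₋ ≠ 0` (**`hyperelliptic_rational_orders_aux`**).  Result:
**`unprojectedDense_hyperelliptic_rationalFibre_of_normDegree`** — `P` monic of degree `≥ 3` with a
simple root, `(A, B), (A', B') ≠ 0` with `deg(A² − PB²) ≠ deg(A'² − PB'²)`: every irreducible `S` of
dimension `≤ 2` containing the graph of `f` over the curve is dense (ANY residue class; e.g.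
`f = 1/x₁`, `f = x₀/x₁³`).  Remaining OPEN over `x₁² = P(x₀)`, `deg P ≡ 2 (mod 4)`: rational `f` with
`deg N_R = deg N_Q` (contains the units at infinity; τ-regime, O86).  Decided instances of an OPEN
question (Mantova–Masser, PLMS 2024 §1 p. 5); EC(3,2) OPEN; NOT Schanuel's conjecture (neither used
nor implied); EAC ⇏ SC.
-/

noncomputable section

open Filter Topology Set Complex Polynomial
open Literature.NumberTheory.Transcendental Literature.ModelTheory.Zilber
open Literature.ModelTheory.ExponentialFields

set_option linter.dupNamespace false

namespace Summit.Schanuel.Schanuel.Theorems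

section Hyperelliptic

variable (P A B A' B' : ℂ[X])

/-- **The two orders are not both zero when the norm degrees differ.**  Along the sheets `±Φ`
(`Φ(0) ≠ 0`), if both `f₊ = ψ₁` and `f₋ = ψ₂` have order zero (finite nonzero limits), then
`f₊f₋ = N_R(x₀)/N_Q(x₀)` has a finite nonzero limit as `x₀ = s^{-2} → ∞`, forcing
`deg N_R = deg N_Q`. [folklore] -/
theorem hyperelliptic_rational_orders_aux (hN : A ^ 2 - P * B ^ 2 ≠ 0)
    (hN' : A' ^ 2 - P * B' ^ 2 ≠ 0)
    (hdeg : (A ^ 2 - P * B ^ 2).natDegree ≠ (A' ^ 2 - P * B' ^ 2).natDegree) {Φ : ℂ → ℂ}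
    (hsheet : ∀ᶠ s in 𝓝[≠] (0 : ℂ), (Φ s * (s ^ P.natDegree)⁻¹) ^ 2 - P.eval (s ^ 2)⁻¹ = 0)
    {ψ₁ ψ₂ : ℂ → ℂ} (hψ₁ : AnalyticAt ℂ ψ₁ 0) (hψ₂ : AnalyticAt ℂ ψ₂ 0) (hψ₁0 : ψ₁ 0 ≠ 0)
    (hψ₂0 : ψ₂ 0 ≠ 0)
    (h₁ : ∀ᶠ s in 𝓝[≠] (0 : ℂ), A'.eval (s ^ 2)⁻¹ + Φ s * (s ^ P.natDegree)⁻¹ * B'.eval (s ^ 2)⁻¹ ≠ 0 ∧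
      (A.eval (s ^ 2)⁻¹ + Φ s * (s ^ P.natDegree)⁻¹ * B.eval (s ^ 2)⁻¹) /
        (A'.eval (s ^ 2)⁻¹ + Φ s * (s ^ P.natDegree)⁻¹ * B'.eval (s ^ 2)⁻¹) = ψ₁ s)
    (h₂ : ∀ᶠ s in 𝓝[≠] (0 : ℂ), A'.eval (s ^ 2)⁻¹ + (-Φ) s * (s ^ P.natDegree)⁻¹ * B'.eval (s ^ 2)⁻¹ ≠ 0 ∧
      (A.eval (s ^ 2)⁻¹ + (-Φ) s * (s ^ P.natDegree)⁻¹ * B.eval (s ^ 2)⁻¹) /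
        (A'.eval (s ^ 2)⁻¹ + (-Φ) s * (s ^ P.natDegree)⁻¹ * B'.eval (s ^ 2)⁻¹) = ψ₂ s) : False := by
  set M : ℕ := P.natDegree with hMdef
  set NR : ℂ[X] := A ^ 2 - P * B ^ 2 with hNR
  set NQ : ℂ[X] := A' ^ 2 - P * B' ^ 2 with hNQ
  obtain ⟨UR, hURan, hUR0, hURev⟩ :=
    exists_polarForm_eval NR (U := fun _ : ℂ => (1 : ℂ)) analyticAt_const (k := 2) (by norm_num)
  obtain ⟨UQ, hUQan, hUQ0, hUQev⟩ :=
    exists_polarForm_eval NQ (U := fun _ : ℂ => (1 : ℂ)) analyticAt_const (k := 2) (by norm_num)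
  rw [one_pow, mul_one] at hUR0 hUQ0
  have hUR00 : UR 0 ≠ 0 := by rw [hUR0]; exact Polynomial.leadingCoeff_ne_zero.2 hN
  have hUQ00 : UQ 0 ≠ 0 := by rw [hUQ0]; exact Polynomial.leadingCoeff_ne_zero.2 hN'
  -- the product of the two sheet values: `N_R(x₀) = f₊ f₋ · N_Q(x₀)`
  have hprod : ∀ᶠ s in 𝓝[≠] (0 : ℂ), UR s * s⁻¹ ^ (2 * NR.natDegree) =
      ψ₁ s * ψ₂ s * (UQ s * s⁻¹ ^ (2 * NQ.natDegree)) := by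
    filter_upwards [h₁, h₂, hsheet, self_mem_nhdsWithin] with s hs₁ hs₂ hs hs0
    have hs0' : s ≠ 0 := hs0
    have hz : (Φ s * (s ^ M)⁻¹) ^ 2 = P.eval (s ^ 2)⁻¹ := sub_eq_zero.1 hs
    have hR := hURev s hs0'
    have hQ := hUQev s hs0'
    rw [one_mul, inv_pow] at hR hQ
    rw [Pi.neg_apply] at hs₂
    have e1 : (A.eval (s ^ 2)⁻¹ + Φ s * (s ^ M)⁻¹ * B.eval (s ^ 2)⁻¹) *
        (A.eval (s ^ 2)⁻¹ + -Φ s * (s ^ M)⁻¹ * B.eval (s ^ 2)⁻¹) = NR.eval (s ^ 2)⁻¹ := by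
      rw [hNR, ← sheet_mul_sheet_eq P A B hz]; ring
    have e2 : (A'.eval (s ^ 2)⁻¹ + Φ s * (s ^ M)⁻¹ * B'.eval (s ^ 2)⁻¹) *
        (A'.eval (s ^ 2)⁻¹ + -Φ s * (s ^ M)⁻¹ * B'.eval (s ^ 2)⁻¹) = NQ.eval (s ^ 2)⁻¹ := by
      rw [hNQ, ← sheet_mul_sheet_eq P A' B' hz]; ring
    have hn₁ : A.eval (s ^ 2)⁻¹ + Φ s * (s ^ M)⁻¹ * B.eval (s ^ 2)⁻¹ =
        ψ₁ s * (A'.eval (s ^ 2)⁻¹ + Φ s * (s ^ M)⁻¹ * B'.eval (s ^ 2)⁻¹) := by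
      rw [← hs₁.2, div_mul_cancel₀ _ hs₁.1]
    have hn₂ : A.eval (s ^ 2)⁻¹ + -Φ s * (s ^ M)⁻¹ * B.eval (s ^ 2)⁻¹ =
        ψ₂ s * (A'.eval (s ^ 2)⁻¹ + -Φ s * (s ^ M)⁻¹ * B'.eval (s ^ 2)⁻¹) := by
      rw [← hs₂.2, div_mul_cancel₀ _ hs₂.1]
    rw [← hR, ← hQ, ← e1, ← e2, hn₁, hn₂]
    ring
  -- limits
  have hψt : Tendsto (fun s => ψ₁ s * ψ₂ s * UQ s) (𝓝[≠] (0 : ℂ)) (𝓝 (ψ₁ 0 * ψ₂ 0 * UQ 0)) :=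
    ((hψ₁.continuousAt.tendsto.mul hψ₂.continuousAt.tendsto).mul hUQan.continuousAt.tendsto).mono_left
      nhdsWithin_le_nhds
  have hURt : Tendsto UR (𝓝[≠] (0 : ℂ)) (𝓝 (UR 0)) :=
    hURan.continuousAt.tendsto.mono_left nhdsWithin_le_nhds
  have hst : Tendsto (fun s : ℂ => s) (𝓝[≠] (0 : ℂ)) (𝓝 0) := tendsto_id.mono_left nhdsWithin_le_nhds
  have hne : ψ₁ 0 * ψ₂ 0 * UQ 0 ≠ 0 := mul_ne_zero (mul_ne_zero hψ₁0 hψ₂0) hUQ00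
  rcases Nat.lt_or_gt_of_ne hdeg with hlt | hgt
  · -- `deg N_R < deg N_Q`: `ψ₁ψ₂U_Q = U_R · s^{2d+2} → 0`
    obtain ⟨d, hd⟩ := Nat.exists_eq_add_of_lt hlt
    have key : ∀ᶠ s in 𝓝[≠] (0 : ℂ), ψ₁ s * ψ₂ s * UQ s = UR s * s ^ (2 * d + 2) := by
      filter_upwards [hprod, self_mem_nhdsWithin] with s hs hs0
      have hs0' : s ≠ 0 := hs0
      rw [hd, show 2 * (NR.natDegree + d + 1) = 2 * NR.natDegree + (2 * d + 2) by ring, pow_add] at hs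
      have hpow : s⁻¹ ^ (2 * NR.natDegree) ≠ 0 := pow_ne_zero _ (inv_ne_zero hs0')
      have h2 : UR s = ψ₁ s * ψ₂ s * UQ s * s⁻¹ ^ (2 * d + 2) :=
        mul_right_cancel₀ hpow (by linear_combination hs)
      rw [h2, mul_assoc (ψ₁ s * ψ₂ s * UQ s), ← mul_pow, inv_mul_cancel₀ hs0', one_pow, mul_one]
    have hlim0 : Tendsto (fun s => UR s * s ^ (2 * d + 2)) (𝓝[≠] (0 : ℂ)) (𝓝 0) := by
      have h := hURt.mul (hst.pow (2 * d + 2))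
      rw [zero_pow (by omega), mul_zero] at h
      exact h
    exact hne (tendsto_nhds_unique (hψt.congr' key) hlim0)
  · -- `deg N_R > deg N_Q`: `U_R = ψ₁ψ₂U_Q · s^{2d+2} → 0`
    obtain ⟨d, hd⟩ := Nat.exists_eq_add_of_lt hgt
    have key : ∀ᶠ s in 𝓝[≠] (0 : ℂ), UR s = ψ₁ s * ψ₂ s * UQ s * s ^ (2 * d + 2) := by
      filter_upwards [hprod, self_mem_nhdsWithin] with s hs hs0
      have hs0' : s ≠ 0 := hs0
      rw [hd, show 2 * (NQ.natDegree + d + 1) = 2 * NQ.natDegree + (2 * d + 2) by ring, pow_add] at hs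
      have hpow : s⁻¹ ^ (2 * NQ.natDegree) ≠ 0 := pow_ne_zero _ (inv_ne_zero hs0')
      have h2 : UR s * s⁻¹ ^ (2 * d + 2) = ψ₁ s * ψ₂ s * UQ s :=
        mul_right_cancel₀ hpow (by linear_combination hs)
      rw [← h2, mul_assoc (UR s), ← mul_pow, inv_mul_cancel₀ hs0', one_pow, mul_one]
    have hlim0 : Tendsto (fun s => ψ₁ s * ψ₂ s * UQ s * s ^ (2 * d + 2)) (𝓝[≠] (0 : ℂ)) (𝓝 0) := by
      have h := hψt.mul (hst.pow (2 * d + 2))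
      rw [zero_pow (by omega), mul_zero] at h
      exact h
    exact hUR00 (tendsto_nhds_unique (hURt.congr' key) hlim0)

/-- **Rational fibres over `x₁² = P(x₀)`, `deg P ≥ 3`, with `deg N_R ≠ deg N_Q`: dense** (any
residue class).  `P` monic of degree `≥ 3` with a simple root; `(A, B), (A', B') ≠ (0, 0)` with
`deg(A² − PB²) ≠ deg(A'² − PB'²)`; `S` irreducible closed of dimension `≤ 2` containing the graph of
`(A + x₁B)/(A' + x₁B')` over the curve off the poles. [cite: MantovaMasser2023, §1 Further remarks,
p. 5 (the question, open in general)] (new) -/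
theorem unprojectedDense_hyperelliptic_rationalFibre_of_normDegree (hP : P.Monic)
    (hM : 3 ≤ P.natDegree) {r : ℂ} (hr : P.IsRoot r) (hr1 : P.derivative.eval r ≠ 0)
    (hAB : A ≠ 0 ∨ B ≠ 0) (hAB' : A' ≠ 0 ∨ B' ≠ 0)
    (hdeg : (A ^ 2 - P * B ^ 2).natDegree ≠ (A' ^ 2 - P * B' ^ 2).natDegree)
    {S : Set (Fin 2 ⊕ Fin 2 → ℂ)} (hS : IsIrreducibleClosed ℂ S) (hdim : zariskiDim ℂ S ≤ (2 : ℕ))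
    (hsub : ∀ x y : ℂ, y ^ 2 = P.eval x → A'.eval x + y * B'.eval x ≠ 0 →
      (Sum.elim ![x, y] ![(A.eval x + y * B.eval x) / (A'.eval x + y * B'.eval x), Complex.exp y] :
        Fin 2 ⊕ Fin 2 → ℂ) ∈ S) :
    UnprojectedDense S := by
  classical
  set M : ℕ := P.natDegree with hMdef
  have hN : A ^ 2 - P * B ^ 2 ≠ 0 := sq_sub_mul_sq_ne_zero P A B hr hr1 hAB
  have hN' : A' ^ 2 - P * B' ^ 2 ≠ 0 := sq_sub_mul_sq_ne_zero P A' B' hr hr1 hAB'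
  obtain ⟨Φ, hΦan, hΦ0, hflat, hsheet⟩ :=
    superelliptic_sheet_facts_flat P (k := 2) (by norm_num) hP (by omega) (one_pow 2)
  have hΦan' : AnalyticAt ℂ (-Φ) 0 := hΦan.neg
  have hsheet' : ∀ᶠ s in 𝓝[≠] (0 : ℂ), ((-Φ) s * (s ^ M)⁻¹) ^ 2 - P.eval (s ^ 2)⁻¹ = 0 := by
    filter_upwards [hsheet] with s hs
    rw [Pi.neg_apply, neg_mul, neg_sq]
    exact hs
  have hflat' : ∃ K : ℝ, ∀ᶠ s in 𝓝 (0 : ℂ), ‖(-Φ) s - (-Φ) 0‖ ≤ K * ‖s‖ ^ 2 := by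
    obtain ⟨K, hK⟩ := hflat
    refine ⟨K, ?_⟩
    filter_upwards [hK] with s hs
    rw [Pi.neg_apply, Pi.neg_apply, neg_sub_neg, norm_sub_rev]
    exact hs
  -- normal forms of numerator and denominator on both sheets
  obtain ⟨ψR₁, LR₁, hψR₁, hψR₁0, hfR₁⟩ := exists_hyperellipticSheet_normalForm P A B hΦan hsheet hN
  obtain ⟨ψQ₁, LQ₁, hψQ₁, hψQ₁0, hfQ₁⟩ := exists_hyperellipticSheet_normalForm P A' B' hΦan hsheet hN'
  obtain ⟨ψR₂, LR₂, hψR₂, hψR₂0, hfR₂⟩ := exists_hyperellipticSheet_normalForm P A B hΦan' hsheet' hN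
  obtain ⟨ψQ₂, LQ₂, hψQ₂, hψQ₂0, hfQ₂⟩ := exists_hyperellipticSheet_normalForm P A' B' hΦan' hsheet' hN'
  -- quotient data on a sheet
  have hquot : ∀ {Θ ψR ψQ : ℂ → ℂ} {LR LQ : ℤ}, AnalyticAt ℂ ψR 0 → AnalyticAt ℂ ψQ 0 → ψR 0 ≠ 0 →
      ψQ 0 ≠ 0 →
      (∀ᶠ s in 𝓝[≠] (0 : ℂ), A.eval (s ^ 2)⁻¹ + Θ s * (s ^ M)⁻¹ * B.eval (s ^ 2)⁻¹ = ψR s * s ^ LR) →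
      (∀ᶠ s in 𝓝[≠] (0 : ℂ), A'.eval (s ^ 2)⁻¹ + Θ s * (s ^ M)⁻¹ * B'.eval (s ^ 2)⁻¹ = ψQ s * s ^ LQ) →
      ∀ᶠ s in 𝓝[≠] (0 : ℂ), A'.eval (s ^ 2)⁻¹ + Θ s * (s ^ M)⁻¹ * B'.eval (s ^ 2)⁻¹ ≠ 0 ∧
        (A.eval (s ^ 2)⁻¹ + Θ s * (s ^ M)⁻¹ * B.eval (s ^ 2)⁻¹) /
          (A'.eval (s ^ 2)⁻¹ + Θ s * (s ^ M)⁻¹ * B'.eval (s ^ 2)⁻¹) =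
            ψR s / ψQ s * s ^ (LR - LQ) := by
    intro Θ ψR ψQ LR LQ hR hQ hR0 hQ0 hfR hfQ
    have hQne : ∀ᶠ s in 𝓝 (0 : ℂ), ψQ s ≠ 0 := hQ.continuousAt.eventually_ne hQ0
    filter_upwards [hfR, hfQ, eventually_nhdsWithin_of_eventually_nhds hQne, self_mem_nhdsWithin]
      with s h1 h2 hQs hs0
    have hs0' : s ≠ 0 := hs0
    refine ⟨by rw [h2]; exact mul_ne_zero hQs (zpow_ne_zero _ hs0'), ?_⟩
    rw [h1, h2, zpow_sub₀ hs0']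
    field_simp
  have hq₁ := hquot hψR₁ hψQ₁ hψR₁0 hψQ₁0 hfR₁ hfQ₁
  have hq₂ := hquot hψR₂ hψQ₂ hψR₂0 hψQ₂0 hfR₂ hfQ₂
  have hψ₁an : AnalyticAt ℂ (fun s => ψR₁ s / ψQ₁ s) 0 := hψR₁.div hψQ₁ hψQ₁0
  have hψ₂an : AnalyticAt ℂ (fun s => ψR₂ s / ψQ₂ s) 0 := hψR₂.div hψQ₂ hψQ₂0
  have hψ₁0 : (fun s => ψR₁ s / ψQ₁ s) 0 ≠ 0 := div_ne_zero hψR₁0 hψQ₁0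
  have hψ₂0 : (fun s => ψR₂ s / ψQ₂ s) 0 ≠ 0 := div_ne_zero hψR₂0 hψQ₂0
  -- the cylinder germs lie in `S`
  have hgerm : ∀ {Θ ψ : ℂ → ℂ} {L : ℤ},
      (∀ᶠ s in 𝓝[≠] (0 : ℂ), (Θ s * (s ^ M)⁻¹) ^ 2 - P.eval (s ^ 2)⁻¹ = 0) →
      (∀ᶠ s in 𝓝[≠] (0 : ℂ), A'.eval (s ^ 2)⁻¹ + Θ s * (s ^ M)⁻¹ * B'.eval (s ^ 2)⁻¹ ≠ 0 ∧
        (A.eval (s ^ 2)⁻¹ + Θ s * (s ^ M)⁻¹ * B.eval (s ^ 2)⁻¹) /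
          (A'.eval (s ^ 2)⁻¹ + Θ s * (s ^ M)⁻¹ * B'.eval (s ^ 2)⁻¹) = ψ s * s ^ L) →
      ∀ᶠ s in 𝓝[≠] (0 : ℂ), (Sum.elim ![(s ^ 2)⁻¹, Θ s * (s ^ M)⁻¹]
          ![ψ s * s ^ L, Complex.exp (Θ s * (s ^ M)⁻¹)] : Fin 2 ⊕ Fin 2 → ℂ) ∈ S := by
    intro Θ ψ L hsh hf
    filter_upwards [hsh, hf] with s hs hfs
    have hy : (Θ s * (s ^ M)⁻¹) ^ 2 = P.eval (s ^ 2)⁻¹ := sub_eq_zero.1 hs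
    have hd : A'.eval (s ^ 2)⁻¹ + Θ s * (s ^ M)⁻¹ * B'.eval (s ^ 2)⁻¹ ≠ 0 := hfs.1
    have hpt := hsub _ _ hy hd
    rw [hfs.2] at hpt
    exact hpt
  by_cases hL₁ : LR₁ - LQ₁ ≠ 0
  · exact unprojectedDense_branch_poleFibre_of_flat hS hdim (by norm_num) (by omega) hL₁ hψ₁an hψ₁0
      hΦan (by rw [hΦ0]; exact one_ne_zero) hflat (hgerm hsheet hq₁)
  · by_cases hL₂ : LR₂ - LQ₂ ≠ 0
    · exact unprojectedDense_branch_poleFibre_of_flat hS hdim (by norm_num) (by omega) hL₂ hψ₂an hψ₂0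
        hΦan' (by rw [Pi.neg_apply, hΦ0]; norm_num) hflat' (hgerm hsheet' hq₂)
    · exfalso
      push Not at hL₁ hL₂
      refine hyperelliptic_rational_orders_aux P A B A' B' hN hN' hdeg hsheet hψ₁an hψ₂an hψ₁0 hψ₂0
        ?_ ?_
      · filter_upwards [hq₁] with s hs
        refine ⟨hs.1, ?_⟩
        rw [hs.2, hL₁, zpow_zero, mul_one]
      · filter_upwards [hq₂] with s hs
        refine ⟨hs.1, ?_⟩
        rw [hs.2, hL₂, zpow_zero, mul_one]

end Hyperelliptic

end Summit.Schanuel.Schanuel.Theorems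

end
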